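import Literature.IUT.HodgeArakelov.ModelMonoThetaCor110Origin
import Literature.IUT.HodgeArakelov.ModelReconstructionInvarianceTateThm16
import Literature.IUT.HodgeArakelov.EtaleThetaDataOfSettingThm16

/-!
# [IUTchII] Cor. 1.10 at the GENUINE natural system, III: NO FACT-policy [EtTh] §2 input — the binders
# «[EtTh] Cor. 2.18 (i) at level `1`» (and, levelwise, Cor. 2.18 (i) / 2.19 (i) at level `M`) SUPPLIED from the
# [EtTh] Thm. 1.6 (i) sub-DAG inputs (proof-only)

S. Mochizuki, *Inter-universal Teichmüller theory II*, §1, Cor. 1.10, kurims manuscript p. 47 l. 15–27 (VERBATIM, own fetch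
paper:url-5036b4059555 p0047): "Then the data consisting of the topological group `Π`, the topological `Π`-modules
constituted by the domain and codomain of (∗mono-Θ_Π), and the isomorphism (∗mono-Θ_Π) determines a functor `ℛ → ℱ` [i.e.,
where `ℱ` denotes the category defined in the evident way so as to accommodate the data just listed] which arises from a
functorial algorithm in the topological group `Π`; denote the corresponding graph [cf. Example 1.9, (i)] by `ℛ†`. In
particular, the resulting natural functor `Ψ_ℛ : ℛ → ℛ†` [cf. Example 1.9, (i)] is multiradially defined."
[claim: Mochizuki2012, status: disputed] (IUTchII §1 Cor 1.10, kurims p.47); [EtTh] Cor. 2.18 (i) PRIMS PDF p. 60 (printed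
p. 286), proof p. 62: "An algorithm for constructing the subquotients … is described in the proofs of Propositions 1.8, 2.4
… (respectively, in the proof of [Mzk2], Lemma 1.3.8). An algorithm for constructing the labels of cuspidal decomposition
groups is described in the proof of Corollary 2.9" [cite: MochizukiEtTh2009, Cor 2.18(i) p.60]; Cor. 2.18 (iv) p. 61,
Cor. 2.19 (i) p. 64.

abc-iut cell, layer L6; seat abc-iut-w4-d038 (gen 3; the SUBDAG-IUTchII-Cor-110 row C110-S10 GENUINE-LIMIT lineage:
`ModelMonoThetaModulesLim` p418598, `ModelMonoThetaBaseDatumLim` p418704; abc-iut-w5-d145's origin form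
`ModelMonoThetaCor110Origin` p419795). PROOF-ONLY companion (no definition, no new named fact). Those files prove
[IUTchII] Cor. 1.10 at the genuine natural projective system of model mono-theta environments of `X̲̲_K` modulo ONE
FACT-policy [EtTh] §2 input, BY NAME: `h218i₁ : (levelRigid … 1).Cor218_i` ([EtTh] Cor. 2.18 (i) at level `1`,
abc-iut-L2-t2's `RigidData.Cor218_i`, FACT-LIST F-0620) — and the levelwise identification of `ρ_B` with the lift
action (`rhoBLim_level_eq_iso`, [EtTh] Cor. 2.18 (iv) / 2.19 (i)) takes `Cor218_i` and `Cor219_i_splittings` at level `M`.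
abc-iut-L6-d6 (gen 3) DERIVED both at the §1 model from the inputs of the [EtTh] Thm. 1.6 (i) sub-DAG
(`plan/L2/SUBDAG-EtTh-Thm16.md`): `rigidData_cor218_i_of_thm16Inputs` (`Discharge/Sec2Cor218iModel`, p420155) and
`cor219_i_splittings_model_of_thm16Inputs` (`ModelReconstructionInvarianceTateThm16`, "8b", p420765); and the
`Π^tp_{Ÿ}`-clause (H1) of the Prop. 1.4 output likewise (`EtaleThetaDataOfSetting.piYddCharacteristic_of_thm16Inputs`,
p420907). THIS FILE is the composition at the LIMIT (every level `M` of the natural system at once):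

* `EtaleLevels.levelRigid_cor218_i_of_thm16Inputs` / `levelRigid_cor219_i_splittings_of_thm16Inputs` — [EtTh] Cor. 2.18 (i)
  and Cor. 2.19 (i) at EVERY level `M` of the genuine natural system, from the Thm. 1.6 (i) inputs;
* `EtaleLevels.cor110_multiradiallyDefined_modelLim_of_thm16Inputs` — Cor. 1.10's printed conclusion ("`Ψ_ℛ : ℛ → ℛ†` is
  multiradially defined") at the genuine natural system;
* `EtaleLevels.familyLim_models_of_thm16Inputs` — the junction C110-S10: the functorial family MODELS the genuine output
  `((l·Δ_Θ)(𝕄_*), Π_μ(𝕄_*), (∗mono-Θ))` of Props. 1.4 / 1.5 (iii) with its pinned module structures, (H1) from the same inputs;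
* `EtaleLevels.rhoBLim_level_of_thm16Inputs` / `rhoBLim_level_eq_iso_of_thm16Inputs` — THE LEVELWISE NATURALITY: at every
  level `M`, `ρ_B(γ)` acts on `Π_μ(𝕄_M) = μ_M` by the coefficient automorphism `γ̄_μ`, i.e. by EVERY automorphism `α` of the
  level-`M` model mono-theta environment lying over `γ` ([EtTh] Cor. 2.18 (iv) / 2.19 (i)), with Cor. 2.18 (i) AND
  Cor. 2.19 (i) at level `M` both supplied from the Thm. 1.6 (i) inputs (+ temp-slimness of `Π^tp_X`, the §1 origin
  hypotheses); `exists_over_rhoBLim_level_eq_iso_of_thm16Inputs` — conversely EVERY automorphism of the level-`M` model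
  mono-theta environment lies over some `γ ∈ Aut(Π^tp_{X̲̲})` (Cor. 2.18 (iii) from temp-slimness) and is then the `M`-component
  of `ρ_B(γ)`.

(Non-vacuity of abc-iut-w5-d145's interface `MonoThetaBaseDatum` at `Π₀ = Π^tp_{X̲̲}` is ALREADY the landed
`nonempty_monoThetaBaseDatum_of_origin`, whose conclusion does not mention the Cor. 2.18 (i) binder; not restated here.)
Residual inputs of IUTchII:Cor1.10 at the genuine natural system after this file, BY NAME (all recorded campaign-M rows, NO
FACT-policy [EtTh] §2 statement): K-core extension only `hext₀` (GAP-LEDGER G-L6d6-2, weakest form), [AbsAnab] Lem. 1.3.8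
`hΔ`, `Thm16Sub.KerToZIsCompactlyGenerated` (L02, G-L6d6-1), `Thm16Sub.GKNIsKernelOfAction D 2` (L04, G-w5d051-1),
`Thm16Sub.GtpYNFromCusp D 2` (L05), `D.IsoPreservesCuspidalDecomp D` (L03, [SemiAnbd] Thm. 6.5 (iii)), a cusp of `Y^log` in
`Π^tp_Y` (`hex`), the Cor. 2.9 cusp-label clause `hcusp`, [EtTh] Prop. 1.5 (iii) `Prop15iii`, the cusp labels `CuspLabels`,
`IsEtThOrigin`, `hYcl` (G-w4d021-2) — plus `IsSlimGroup Π^tp_X` (G-w4d021-3) for the Cor. 2.19 (i) clause only.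
HONEST FRAMING: CONDITIONAL composition modulo the inputs listed, which are NOT asserted; [EtTh] is refereed, the [IUTchII]
claim key `Mochizuki2012` is DISPUTED (D-0012); nothing disputed is asserted; no side is taken on [IUTchIII] Cor. 3.12;
typed ≠ discharged.
-/

noncomputable section

namespace Literature.IUT.HodgeArakelov

open CategoryTheory Literature.AnabelianGeometry.EtaleTheta Literature.AnabelianGeometry.SemiGraphs
open Literature.AlgebraicGeometry.Frobenioids (IsSlimGroup)
open scoped Literature.AnabelianGeometry.EtaleTheta

namespace EtaleLevels

variable {p : ℕ} [Fact p.Prime] {D : Literature.AnabelianGeometry.EtaleTheta.ThetaSetting p}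
  {E : D.EtaleThetaData} {l : ℕ} (C : E.DoubleUnderline l) (hC : D.Compat) (hS : D.Sec2Hyps)
  (hl : l.Prime) (hp2 : p ≠ 2) (hpl : p ≠ l) (hζ : ∃ ζ : D.K, IsPrimitiveRoot ζ (4 * l))
  (mods : ∀ M : ℕ+, D.CyclotomeMod l M)
  (f : contCocycles D.toTheta D.DeltaTheta C.GtpYdduu) (hf : f ∈ C.rootCocycles hC)
  (hmods : ∀ (M M' : ℕ+) (h : (M : ℕ) ∣ (M' : ℕ)) (x : D.lDeltaTheta l),
    MuN.red p M M' h ((mods M').red x) = (mods M).red x)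
  (h15 : Literature.AnabelianGeometry.EtaleTheta.ThetaSetting.Prop15iii E hC) (L : C.CuspLabels)
  (hslimX : IsSlimGroup D.PiTemp)
  (hext₀ : ∀ γ : ↥C.Huu ≃ₜ* ↥C.Huu, ∃ Γ : D.PiTemp ≃ₜ* D.PiTemp,
    ∀ h : C.Huu, Γ (h : D.PiTemp) = ((γ h : C.Huu) : D.PiTemp))
  (hΔ : ∀ Γ : D.PiTemp ≃ₜ* D.PiTemp, D.DeltaTemp.map Γ.toMulEquiv.toMonoidHom = D.DeltaTemp)
  (hZ : Thm16Sub.KerToZIsCompactlyGenerated D) (hK : Thm16Sub.GKNIsKernelOfAction D 2)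
  (hYN : Thm16Sub.GtpYNFromCusp D 2) (h65 : D.IsoPreservesCuspidalDecomp D.toTemperedCurve)
  (hex : ∃ Dc : Subgroup D.PiTemp, D.IsCuspidalDecompositionGroup Dc ∧ Dc ≤ D.GtpY)
  (hcusp : ∀ (γ : ↥C.Huu ≃ₜ* ↥C.Huu) (a : ZMod l),
    (fun H : Subgroup C.Huu => H.map γ.toMulEquiv.toMonoidHom) '' L.cuspX a = L.cuspX a)
  (hO : D.IsEtThOrigin)
  (hYcl : (D.DtpY.map D.toHat.toMonoidHom).topologicalClosure ≤
    D.DtpY.map D.toHat.toMonoidHom ⊔ (⁅⁅D.DeltaHat, D.DeltaHat⁆, D.DeltaHat⁆).topologicalClosure)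

/-! ## [EtTh] Cor. 2.18 (i) / 2.19 (i) at every level of the genuine natural system -/

include hext₀ hΔ hZ hK hYN h65 hex hcusp in
/-- **[EtTh] Cor. 2.18 (i) at EVERY level `M` of the genuine natural system, from the Thm. 1.6 (i) sub-DAG inputs**:
abc-iut-L6-d6's `rigidData_cor218_i_of_thm16Inputs` (p420155) read at the level-`M` model rigid data
`levelRigid … M = C.rigidData (mods M) hC hS h15 L`. [cite: MochizukiEtTh2009, Cor 2.18(i) p.60] -/
theorem levelRigid_cor218_i_of_thm16Inputs (M : ℕ+) : (levelRigid C hC hS mods h15 L M).Cor218_i :=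
  C.rigidData_cor218_i_of_thm16Inputs (mods M) hC hS h15 L hext₀ hΔ hZ hK hYN h65 hex hcusp

include hslimX hext₀ hΔ hZ hK hYN h65 hex hcusp hO hYcl in
/-- **[EtTh] Cor. 2.19 (i) (splittings) at EVERY level `M` of the genuine natural system, from the Thm. 1.6 (i) sub-DAG
inputs** (+ temp-slimness of `Π^tp_X` and the §1 origin hypotheses): abc-iut-L6-d6's
`cor219_i_splittings_model_of_thm16Inputs` ("8b", p420765) at `μ := mods M`. [cite: MochizukiEtTh2009, Cor 2.19(i) p.64] -/
theorem levelRigid_cor219_i_splittings_of_thm16Inputs (M : ℕ+) :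
    (levelRigid C hC hS mods h15 L M).Cor219_i_splittings :=
  Literature.IUT.HodgeArakelov.ThetaSetting.cor219_i_splittings_model_of_thm16Inputs C (mods M) hC hS h15 L hslimX
    hext₀ hΔ hZ hK hYN h65 hex hcusp hO hYcl

/-! ## [IUTchII] Cor. 1.10 at the genuine natural system with no FACT-policy [EtTh] §2 input -/

/-- **[IUTchII] Cor. 1.10 AT THE GENUINE NATURAL SYSTEM, Thm. 1.6 (i)-inputs form**: for the functor `ℛ → ℱ` of the functorial
family `familyLim` over the natural system — its input "`(l·Δ_Θ)(M) ≅ Ẑ`" abc-iut-L2-d1's theorem (as in abc-iut-w5-d145's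
`cor110_multiradiallyDefined_modelLim_of_origin`) and its input [EtTh] Cor. 2.18 (i) at level `1` NOW SUPPLIED by
`levelRigid_cor218_i_of_thm16Inputs … 1` — "the resulting natural functor `Ψ_ℛ : ℛ → ℛ†` is multiradially defined".
[claim: Mochizuki2012, status: disputed] (IUTchII §1 Cor 1.10, kurims p.47) -/
theorem cor110_multiradiallyDefined_modelLim_of_thm16Inputs (Γxμ : Type) [Group Γxμ] :
    ((ex18iii (setting C hC hS hl hp2 hpl hζ mods f hf) Γxμ).toDagger
      (CategoryTheory.Prod.fst _ _ ⋙
        (familyLim C hC hS hl hp2 hpl hζ mods f hf hmods h15 L (fun M =>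
            ModelCyclotomes.nonempty_lDeltaQuot_rigidData_mulEquiv_zHat C (mods M) hC hS h15 L hO hYcl hl.ne_zero)
          (levelRigid_cor218_i_of_thm16Inputs C hC hS mods h15 L hext₀ hΔ hZ hK hYN h65 hex hcusp
            1)).toRigidityFunctor.Ξ)).IsMultiradiallyDefined :=
  cor110_multiradiallyDefined_modelLim_of_origin C hC hS hl hp2 hpl hζ mods f hf hmods h15 L hO hYcl _ Γxμ

/-- **IUTchII:Cor1.10, the junction C110-S10 AT THE GENUINE NATURAL SYSTEM, Thm. 1.6 (i)-inputs form**: the functorial family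
`familyLim` MODELS (abc-iut-w5-d145's `MonoThetaRigidityData.Models`) the genuine output `((l·Δ_Θ)(𝕄_*), Π_μ(𝕄_*), (∗mono-Θ))`
of [IUTchII] Props. 1.4 / 1.5 (iii) with its pinned module structures — abc-iut-w4-d038's `familyLim_models` with `hZ` from
abc-iut-L2-d1's theorem, the `Π^tp_{Ÿ}`-clause (H1) of the Prop. 1.4 output from abc-iut-L6-d6's
`piYddCharacteristic_of_thm16Inputs` (p420907), and `ρ_A`'s input Cor. 2.18 (i) at level `1` from
`levelRigid_cor218_i_of_thm16Inputs`. Residual inputs BY NAME: `hext₀`, `hΔ`, L02/L04/L05/L03, `hex`, `hcusp`, `Prop15iii`,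
`CuspLabels`, `IsEtThOrigin`, `hYcl` — no FACT-policy [EtTh] §2 statement.
[claim: Mochizuki2012, status: disputed] (IUTchII §1 Cor 1.10, kurims p.47) -/
theorem familyLim_models_of_thm16Inputs :
    (familyLim C hC hS hl hp2 hpl hζ mods f hf hmods h15 L (fun M =>
        ModelCyclotomes.nonempty_lDeltaQuot_rigidData_mulEquiv_zHat C (mods M) hC hS h15 L hO hYcl hl.ne_zero)
      (levelRigid_cor218_i_of_thm16Inputs C hC hS mods h15 L hext₀ hΔ hZ hK hYN h65 hex hcusp 1)).Models
      (thetaEnvData C hC hS hl hp2 hpl hζ mods f hf hmods h15 L (fun M =>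
          ModelCyclotomes.nonempty_lDeltaQuot_rigidData_mulEquiv_zHat C (mods M) hC hS h15 L hO hYcl hl.ne_zero)
        (EtaleThetaDataOfSetting.piYddCharacteristic_of_thm16Inputs C hext₀ hΔ hZ hK hYN h65 hex)
        (bijective_rigidLimHom C hC hS hl hp2 hpl hζ mods f hf hmods h15 L (fun M =>
          ModelCyclotomes.nonempty_lDeltaQuot_rigidData_mulEquiv_zHat C (mods M) hC hS h15 L hO hYcl hl.ne_zero)))
      (moduleStrLim C hC hS hl hp2 hpl hζ mods f hf hmods h15 L (fun M =>
          ModelCyclotomes.nonempty_lDeltaQuot_rigidData_mulEquiv_zHat C (mods M) hC hS h15 L hO hYcl hl.ne_zero)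
        (EtaleThetaDataOfSetting.piYddCharacteristic_of_thm16Inputs C hext₀ hΔ hZ hK hYN h65 hex)) :=
  familyLim_models C hC hS hl hp2 hpl hζ mods f hf hmods h15 L _ _
    (levelRigid_cor218_i_of_thm16Inputs C hC hS mods h15 L hext₀ hΔ hZ hK hYN h65 hex hcusp 1)

/-! ## The levelwise naturality of `ρ_B` ([EtTh] Cor. 2.18 (iv) / 2.19 (i)) with no FACT-policy input -/

/-- **`ρ_B(γ)` acts on each level `Π_μ(𝕄_M) = μ_M` by the COEFFICIENT AUTOMORPHISM `γ̄_μ` of that level — Thm. 1.6 (i)-inputs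
form** of abc-iut-w4-d038's `rhoBLim_level`: Cor. 2.18 (i) at level `1` (for `ρ_A`/`ρ_B`) and at level `M` (for `γ̄_μ`,
abc-iut-w5-d145's `ModelCyclotomes.coeffAut`) both from `levelRigid_cor218_i_of_thm16Inputs`.
[cite: MochizukiEtTh2009, Cor 2.18(iv) p.61] -/
theorem rhoBLim_level_of_thm16Inputs (M : ℕ+)
    (γ : (levelRigid C hC hS mods h15 L 1).PiX ≃ₜ* (levelRigid C hC hS mods h15 L 1).PiX)
    (y : ↥(modelSystem C hC hS hl hp2 hpl hζ mods f hf hmods h15 L (fun M =>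
      ModelCyclotomes.nonempty_lDeltaQuot_rigidData_mulEquiv_zHat C (mods M) hC hS h15 L hO hYcl hl.ne_zero)).extCycLim)
    (a : (levelData C hC hS mods M).mu)
    (hy : (y : ∀ M', ((modelSystem C hC hS hl hp2 hpl hζ mods f hf hmods h15 L (fun M =>
        ModelCyclotomes.nonempty_lDeltaQuot_rigidData_mulEquiv_zHat C (mods M) hC hS h15 L hO hYcl hl.ne_zero)).env
        M').Pi) M =
      (CycEnvelope.inMu (levelData C hC hS mods M).augY (levelData C hC hS mods M).chi a : (levelData C hC hS mods M).env)) :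
    ((rhoBLim C hC hS hl hp2 hpl hζ mods f hf hmods h15 L (fun M =>
          ModelCyclotomes.nonempty_lDeltaQuot_rigidData_mulEquiv_zHat C (mods M) hC hS h15 L hO hYcl hl.ne_zero)
        (levelRigid_cor218_i_of_thm16Inputs C hC hS mods h15 L hext₀ hΔ hZ hK hYN h65 hex hcusp 1) γ y :
        ↥(modelSystem C hC hS hl hp2 hpl hζ mods f hf hmods h15 L (fun M =>
          ModelCyclotomes.nonempty_lDeltaQuot_rigidData_mulEquiv_zHat C (mods M) hC hS h15 L hO hYcl hl.ne_zero)).extCycLim) :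
        ∀ M', ((modelSystem C hC hS hl hp2 hpl hζ mods f hf hmods h15 L (fun M =>
          ModelCyclotomes.nonempty_lDeltaQuot_rigidData_mulEquiv_zHat C (mods M) hC hS h15 L hO hYcl hl.ne_zero)).env
          M').Pi) M =
      (CycEnvelope.inMu (levelData C hC hS mods M).augY (levelData C hC hS mods M).chi
        (ModelCyclotomes.coeffAut (S := levelSetting C hC hS hl hp2 hpl hζ mods f hf M) (levelRigid C hC hS mods h15 L M)
          (levelRigid_cor218_i_of_thm16Inputs C hC hS mods h15 L hext₀ hΔ hZ hK hYN h65 hex hcusp M) γ a) :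
        (levelData C hC hS mods M).env) :=
  rhoBLim_level C hC hS hl hp2 hpl hζ mods f hf hmods h15 L _ _ M _ γ y a hy

include hslimX in
/-- **`ρ_B(γ)` IS THE ACTION OF THE LIFTS, at every level, with NO FACT-policy input** — Thm. 1.6 (i)-inputs form of
abc-iut-w4-d038's `rhoBLim_level_eq_iso` ([EtTh] Cor. 2.18 (iv) / 2.19 (i), SUBDAG-IUTchII-Cor-110 rows S10c/S10d at the
LIMIT): for every automorphism `α` of the level-`M` model mono-theta environment `M(η)` lying over `γ` (on
`Π^tp_{Y̲̲} ⊆ Π^tp_{X̲̲}`), the `M`-component of `ρ_B(γ) y` is `α` applied to the `M`-component of `y`; Cor. 2.18 (i) at levels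
`1` and `M` from `levelRigid_cor218_i_of_thm16Inputs`, Cor. 2.19 (i) at level `M` from
`levelRigid_cor219_i_splittings_of_thm16Inputs` ("8b"). [cite: MochizukiEtTh2009, Cor 2.18(iv) p.61] -/
theorem rhoBLim_level_eq_iso_of_thm16Inputs (M : ℕ+)
    {η : (levelData C hC hS mods M).PiYdd → (levelData C hC hS mods M).mu} (hη : η ∈ (levelData C hC hS mods M).thetaCocycles)
    (α : ((levelData C hC hS mods M).modelMono hη).Iso ((levelData C hC hS mods M).modelMono hη))
    (γ : (levelRigid C hC hS mods h15 L 1).PiX ≃ₜ* (levelRigid C hC hS mods h15 L 1).PiX)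
    (hαγ : ∀ x : (levelData C hC hS mods M).env,
      ((CycEnvelope.proj (levelData C hC hS mods M).augY (levelData C hC hS mods M).chi (α.e x) :
        (levelData C hC hS mods M).PiY) : ↥C.Huu) =
      γ ((CycEnvelope.proj (levelData C hC hS mods M).augY (levelData C hC hS mods M).chi x :
        (levelData C hC hS mods M).PiY) : ↥C.Huu))
    (y : ↥(modelSystem C hC hS hl hp2 hpl hζ mods f hf hmods h15 L (fun M =>
      ModelCyclotomes.nonempty_lDeltaQuot_rigidData_mulEquiv_zHat C (mods M) hC hS h15 L hO hYcl hl.ne_zero)).extCycLim)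
    (a : (levelData C hC hS mods M).mu)
    (hy : (y : ∀ M', ((modelSystem C hC hS hl hp2 hpl hζ mods f hf hmods h15 L (fun M =>
        ModelCyclotomes.nonempty_lDeltaQuot_rigidData_mulEquiv_zHat C (mods M) hC hS h15 L hO hYcl hl.ne_zero)).env
        M').Pi) M =
      (CycEnvelope.inMu (levelData C hC hS mods M).augY (levelData C hC hS mods M).chi a : (levelData C hC hS mods M).env)) :
    ((rhoBLim C hC hS hl hp2 hpl hζ mods f hf hmods h15 L (fun M =>
          ModelCyclotomes.nonempty_lDeltaQuot_rigidData_mulEquiv_zHat C (mods M) hC hS h15 L hO hYcl hl.ne_zero)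
        (levelRigid_cor218_i_of_thm16Inputs C hC hS mods h15 L hext₀ hΔ hZ hK hYN h65 hex hcusp 1) γ y :
        ↥(modelSystem C hC hS hl hp2 hpl hζ mods f hf hmods h15 L (fun M =>
          ModelCyclotomes.nonempty_lDeltaQuot_rigidData_mulEquiv_zHat C (mods M) hC hS h15 L hO hYcl hl.ne_zero)).extCycLim) :
        ∀ M', ((modelSystem C hC hS hl hp2 hpl hζ mods f hf hmods h15 L (fun M =>
          ModelCyclotomes.nonempty_lDeltaQuot_rigidData_mulEquiv_zHat C (mods M) hC hS h15 L hO hYcl hl.ne_zero)).env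
          M').Pi) M =
      α.e ((y : ∀ M', ((modelSystem C hC hS hl hp2 hpl hζ mods f hf hmods h15 L (fun M =>
          ModelCyclotomes.nonempty_lDeltaQuot_rigidData_mulEquiv_zHat C (mods M) hC hS h15 L hO hYcl hl.ne_zero)).env
          M').Pi) M) :=
  rhoBLim_level_eq_iso C hC hS hl hp2 hpl hζ mods f hf hmods h15 L _ _ M
    (levelRigid_cor218_i_of_thm16Inputs C hC hS mods h15 L hext₀ hΔ hZ hK hYN h65 hex hcusp M)
    (levelRigid_cor219_i_splittings_of_thm16Inputs C hC hS mods h15 L hslimX hext₀ hΔ hZ hK hYN h65 hex hcusp hO hYcl M)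
    hη α γ hαγ y a hy

include hslimX in
/-- **EVERY automorphism of EVERY level is realised by `ρ_B`** ([EtTh] Cor. 2.18 (iv) «`Aut(𝕄_M) → Aut(Π^tp_{X̲̲})`» composed
with Cor. 2.19 (i), no FACT-policy input): for every automorphism `α` of the level-`M` model mono-theta environment `M(η)`
there IS a topological automorphism `γ` of `Π^tp_{X̲̲}` over which `α` lies (abc-iut-L2's `exists_gamma_of_cor218` from
Cor. 2.18 (i) at level `M` — Thm. 1.6 (i) inputs — and Cor. 2.18 (iii) from temp-slimness, `cor218_iii_of_tempSlim` /
`tempSlim_Huu`), and then the `M`-component of `ρ_B(γ) y` is `α` applied to the `M`-component of `y`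
(`rhoBLim_level_eq_iso_of_thm16Inputs`). [cite: MochizukiEtTh2009, Cor 2.18(iv) p.61] -/
theorem exists_over_rhoBLim_level_eq_iso_of_thm16Inputs (M : ℕ+)
    {η : (levelData C hC hS mods M).PiYdd → (levelData C hC hS mods M).mu} (hη : η ∈ (levelData C hC hS mods M).thetaCocycles)
    (α : ((levelData C hC hS mods M).modelMono hη).Iso ((levelData C hC hS mods M).modelMono hη))
    (y : ↥(modelSystem C hC hS hl hp2 hpl hζ mods f hf hmods h15 L (fun M =>
      ModelCyclotomes.nonempty_lDeltaQuot_rigidData_mulEquiv_zHat C (mods M) hC hS h15 L hO hYcl hl.ne_zero)).extCycLim)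
    (a : (levelData C hC hS mods M).mu)
    (hy : (y : ∀ M', ((modelSystem C hC hS hl hp2 hpl hζ mods f hf hmods h15 L (fun M =>
        ModelCyclotomes.nonempty_lDeltaQuot_rigidData_mulEquiv_zHat C (mods M) hC hS h15 L hO hYcl hl.ne_zero)).env
        M').Pi) M =
      (CycEnvelope.inMu (levelData C hC hS mods M).augY (levelData C hC hS mods M).chi a : (levelData C hC hS mods M).env)) :
    ∃ γ : (levelRigid C hC hS mods h15 L 1).PiX ≃ₜ* (levelRigid C hC hS mods h15 L 1).PiX,
      (∀ x : (levelData C hC hS mods M).env,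
        ((CycEnvelope.proj (levelData C hC hS mods M).augY (levelData C hC hS mods M).chi (α.e x) :
          (levelData C hC hS mods M).PiY) : ↥C.Huu) =
        γ ((CycEnvelope.proj (levelData C hC hS mods M).augY (levelData C hC hS mods M).chi x :
          (levelData C hC hS mods M).PiY) : ↥C.Huu)) ∧
      ((rhoBLim C hC hS hl hp2 hpl hζ mods f hf hmods h15 L (fun M =>
            ModelCyclotomes.nonempty_lDeltaQuot_rigidData_mulEquiv_zHat C (mods M) hC hS h15 L hO hYcl hl.ne_zero)
          (levelRigid_cor218_i_of_thm16Inputs C hC hS mods h15 L hext₀ hΔ hZ hK hYN h65 hex hcusp 1) γ y :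
          ↥(modelSystem C hC hS hl hp2 hpl hζ mods f hf hmods h15 L (fun M =>
            ModelCyclotomes.nonempty_lDeltaQuot_rigidData_mulEquiv_zHat C (mods M) hC hS h15 L hO hYcl hl.ne_zero)).extCycLim) :
          ∀ M', ((modelSystem C hC hS hl hp2 hpl hζ mods f hf hmods h15 L (fun M =>
            ModelCyclotomes.nonempty_lDeltaQuot_rigidData_mulEquiv_zHat C (mods M) hC hS h15 L hO hYcl hl.ne_zero)).env
            M').Pi) M =
        α.e ((y : ∀ M', ((modelSystem C hC hS hl hp2 hpl hζ mods f hf hmods h15 L (fun M =>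
            ModelCyclotomes.nonempty_lDeltaQuot_rigidData_mulEquiv_zHat C (mods M) hC hS h15 L hO hYcl hl.ne_zero)).env
            M').Pi) M) := by
  obtain ⟨γ, hγ, -, -, -⟩ := (levelRigid C hC hS mods h15 L M).exists_gamma_of_cor218
    (levelRigid_cor218_i_of_thm16Inputs C hC hS mods h15 L hext₀ hΔ hZ hK hYN h65 hex hcusp M)
    ((levelRigid C hC hS mods h15 L M).cor218_iii_of_tempSlim (C.tempSlim_Huu hslimX)).2
    ((levelRigid C hC hS mods h15 L M).cor218_iii_of_tempSlim (C.tempSlim_Huu hslimX)).1 α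
  exact ⟨γ, hγ, rhoBLim_level_eq_iso_of_thm16Inputs C hC hS hl hp2 hpl hζ mods f hf hmods h15 L hslimX hext₀ hΔ hZ hK
    hYN h65 hex hcusp hO hYcl M hη α γ hγ y a hy⟩

end EtaleLevels

end Literature.IUT.HodgeArakelov

end
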